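import Mathlib
import Summits.Ventures.PercRepro2.Defs
import Summits.Ventures.PercRepro2.Graph

/-!
# Skeleton reduction — the definition (mine-a g5; MINE-A.md §25, §34–§36)

`RB.Reducible ends s t b o w p`: the weight vector `p` reduces, by the three exact skeleton
reductions — pruning an unmarked pendant vertex, merging a parallel pair, suppressing an unmarked
degree-2 vertex onto an edge between its neighbours — to a weight vector all of whose nonzero-weight
edges at `w` end in `{s, t, b, o}`. This is the class «the marked skeleton has `N(w) ⊆ {s, t, b, o}`»
of the paper; the typed row 2′RB is a theorem on it (`RB.RBcross_and_RBsame_of_reducible`,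
RBReduce.lean).
-/

namespace Summit.Ventures.PercRepro2

namespace RB

/-- `p` reduces by the three skeleton reductions to «every nonzero-weight edge at `w` ends in
`{s, t, b, o}`». -/
inductive Reducible {V : Type*} {E : Type*} (ends : E → Sym2 V) (s t b o w : V) {R : Type*}
    [Field R] [DecidableEq E] : (E → R) → Prop
  /-- The kernel class: every nonzero-weight edge at `w` ends in `{s, t, b, o}`. -/
  | kernel (p : E → R)
      (H : ∀ e, w ∈ ends e → p e ≠ 0 →
        ends e = s(w, s) ∨ ends e = s(w, t) ∨ ends e = s(w, b) ∨ ends e = s(w, o)) :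
      Reducible ends s t b o w p
  /-- Pruning an unmarked pendant vertex `u` (its single nonzero-weight edge `f = {u, v}`, `v ≠ u`). -/
  | prune (p : E → R) (f : E) (u v : V) (hends : ends f = s(u, v)) (hvu : v ≠ u) (hus : u ≠ s)
      (hut : u ≠ t) (hub : u ≠ b) (huo : u ≠ o) (huw : u ≠ w)
      (huniq : ∀ e, u ∈ ends e → p e ≠ 0 → e = f)
      (h : Reducible ends s t b o w (Function.update p f 0)) :
      Reducible ends s t b o w p
  /-- Merging a parallel pair `e ≠ e′` into `e` of weight `p e + p e′ − p e p e′`. -/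
  | merge (p : E → R) (e e' : E) (hne : e ≠ e') (hpar : ends e = ends e')
      (h : Reducible ends s t b o w (Function.update (Function.update p e (p e + p e' - p e * p e')) e' 0)) :
      Reducible ends s t b o w p
  /-- Suppressing an unmarked degree-2 vertex `u` (its nonzero-weight edges `f₁ = {u, v₁}`,
  `f₂ = {u, v₂}`) onto the edge `e₀ = {v₁, v₂}`, whose weight becomes `p e₀ + (1 − p e₀) p f₁ p f₂`. -/
  | series (p : E → R) (e₀ f₁ f₂ : E) (u v₁ v₂ : V) (hends₀ : ends e₀ = s(v₁, v₂))
      (hends₁ : ends f₁ = s(u, v₁)) (hends₂ : ends f₂ = s(u, v₂)) (hv₁ : v₁ ≠ u) (hv₂ : v₂ ≠ u)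
      (h12 : f₁ ≠ f₂) (h01 : e₀ ≠ f₁) (h02 : e₀ ≠ f₂)
      (huniq : ∀ e, u ∈ ends e → p e ≠ 0 → e = f₁ ∨ e = f₂) (hus : u ≠ s) (hut : u ≠ t)
      (hub : u ≠ b) (huo : u ≠ o) (huw : u ≠ w)
      (h : Reducible ends s t b o w (Function.update (Function.update (Function.update p e₀
        (p e₀ + (1 - p e₀) * (p f₁ * p f₂))) f₁ 0) f₂ 0)) :
      Reducible ends s t b o w p

end RB

end Summit.Ventures.PercRepro2
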